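import Literature.Probability.RandomPlanarGeometry.TwoSidedWholePlaneSLE
import HarnessLib

/-!
# Two-sided whole-plane SLE_κ: towards reversibility — the parametrisation layer

Topic `Probability/RandomPlanarGeometry`; proofs file accompanying `TwoSidedWholePlaneSLE`
(named fact `IsTwoSidedWholePlaneSLENatLaw.map_reversePath`).

`IsTwoSidedWholePlaneSLENatLaw.map_reversePath` is Zhan's reversibility (i) of the two-sided
whole-plane SLE_κ loop ("the reversal of `γ` has the same law (modulo a time change) as `γ`",
Zhan (2021), §2.2 — stated there, without printed proof, as a consequence of the reversibility of
whole-plane SLE_κ(2) (Miller–Sheffield, *Imaginary geometry IV*, Thm 1.20), of chordal SLE_κ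
(Zhan (2008); Miller–Sheffield, *Imaginary geometry III*) and of the resampling property of
two-sided radial SLE_κ), transferred to the Minkowski content parametrisation rooted at `0` as in
the proof of Zhan (2021), Cor. 4.7. Those deep inputs are not in the tree, and neither is the
SLE-law glue (conformal invariance of the chordal law, curves determined by hulls); the fact is not
discharged here.

What is proved is the elementary layer of the transfer, following Zhan (2021), Rem. 2.4 and the
proof of Cor. 4.7 ("for every `γ ∈ Γ₀` there is a unique Minkowski content parametrization of `γ`,
denoted by `𝒫(γ)`, such that `𝒫(γ)(0) = 0`"):

* `HasMinkowskiContent.unique` — Minkowski content, when it exists, is unique;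
  `IsNaturallyParametrized.sub_eq_sub_of_image_eq` — arcs with the same trace have the same
  natural length.
* Rigidity of the natural parametrisation under increasing time changes fixing the time origin:
  on `ℝ` (`IsNaturallyParametrized.orderIso_apply_eq`, `eq_of_orderIso`), on the forward half-line
  (`orderIso_nnreal_apply_eq`, the clause `∃ e : ℝ≥0 ≃o ℝ≥0` of `IsTwoSidedWholePlaneSLENatLaw`)
  and on the backward open half-line (`orderIso_Iio_apply_eq`, the clause `∃ e' : Iio 0 ≃o ℝ`):
  two natural parametrisations of the same arms rooted at time `0` coincide.
* `map_reversePath_map_reversePath` — reversal is an involution on laws; and the reduction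
  `IsTwoSidedWholePlaneSLENatLaw.map_reversePath_of_unique`: granted the well-definedness fact
  `IsTwoSidedWholePlaneSLENatLaw.unique`, reversibility of the natural law is exactly the closure of
  the class of natural laws under `reversePath` (converse `reversePath_of_map_reversePath`).
* The arms determine the natural parametrisation (`IsNaturallyParametrized.eq_of_orderIso_halves`,
  `IsNaturallyParametrized.eq_of_arms`): two naturally parametrised two-sided paths tracing the
  same arm `η₂` on `[0, ∞)` and the same arm `η₁` on `(-∞, 0)` are equal — the uniqueness of
  Zhan's `𝒫(γ)`; hence, on a space carrying the two arms, the natural law is determined by the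
  arms (`natParam_ae_eq_of_arms`, `map_natParam_eq_of_arms`: the parametrisation half of the
  well-definedness fact `IsTwoSidedWholePlaneSLENatLaw.unique`).
* The finer reduction of reversibility to its deep input at the level of ARMS
  (`isTwoSidedWholePlaneSLENatLaw_map_reversePath_of_reversedPair`,
  `IsTwoSidedWholePlaneSLENatLaw.map_reversePath_of_reversedPairs`): if the reversed arms of a
  two-sided whole-plane SLE_κ pair, reparametrised, form again a two-sided whole-plane SLE_κ pair
  on the same probability space (Zhan (2021), §2.2 (i), from Miller–Sheffield IG IV, Thm 1.20,
  chordal reversibility and resampling — NOT in the tree), then the reversed natural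
  parametrisation witnesses `IsTwoSidedWholePlaneSLENatLaw κ (μ.map reversePath)`, and with
  `unique` the fact `map_reversePath` follows.

## References

* D. Zhan, *SLE loop measures*, PTRF 179 (2021), arXiv:1702.08026 (arXiv numbering): §2.2
  (reversibility (i) of two-sided whole-plane SLE_κ), Rem. 2.4, proof of Cor. 4.7 (uniqueness of
  the Minkowski content parametrisation `𝒫(γ)` with `𝒫(γ)(0) = 0`). [Zhan2021SLELoopMeasures]
* J. Miller, S. Sheffield, *Imaginary geometry IV*, PTRF 169 (2017), Thm 1.20. [MillerSheffield2013]
* D. Zhan, *Reversibility of chordal SLE*, Ann. Probab. 36 (2008). [Zhan2008Reversibility]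
-/

noncomputable section

open Set Filter Topology MeasureTheory
open scoped NNReal ENNReal

namespace Literature.Probability.RandomPlanarGeometry

open scoped PathBorel

section Reversibility

/-- Minkowski content, when it exists, is unique (a limit in the Hausdorff space `ℝ≥0∞` along the
non-trivial filter `𝓝[>] 0`). [folklore] -/
theorem HasMinkowskiContent.unique {d : ℝ} {S : Set ℂ} {m m' : ℝ≥0∞}
    (h : HasMinkowskiContent d S m) (h' : HasMinkowskiContent d S m') : m = m' :=
  tendsto_nhds_unique h h'

/-- Arcs of naturally parametrised paths with the same trace have the same natural length: if
`γ[a, b] = γ'[a', b']` for two paths parametrised by `d`-dimensional Minkowski content, then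
`b - a = b' - a'`. [folklore] -/
theorem IsNaturallyParametrized.sub_eq_sub_of_image_eq {d : ℝ} {γ γ' : ℝ → ℂ}
    (h : IsNaturallyParametrized d γ) (h' : IsNaturallyParametrized d γ') {a b a' b' : ℝ}
    (hab : a ≤ b) (hab' : a' ≤ b') (himage : γ '' Icc a b = γ' '' Icc a' b') :
    b - a = b' - a' := by
  have h1 := h a b hab
  rw [himage] at h1
  exact (ENNReal.ofReal_eq_ofReal_iff (sub_nonneg.2 hab) (sub_nonneg.2 hab')).1
    (h1.unique (h' a' b' hab'))

/-- **Rigidity of the natural parametrisation on `ℝ`** (uniqueness of the Minkowski content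
parametrisation with prescribed time origin; Zhan (2021), Rem. 2.4 and proof of Cor. 4.7): if `γ`
and `γ'` are both parametrised by `d`-dimensional Minkowski content and `γ = γ' ∘ θ` for an
increasing time change `θ : ℝ ≃o ℝ` fixing `0`, then `θ = id`.
[cite: Zhan2021SLELoopMeasures, Rem. 2.4 / proof of Cor. 4.7] -/
theorem IsNaturallyParametrized.orderIso_apply_eq {d : ℝ} {γ γ' : ℝ → ℂ}
    (h : IsNaturallyParametrized d γ) (h' : IsNaturallyParametrized d γ') (θ : ℝ ≃o ℝ)
    (hθ : ∀ t, γ t = γ' (θ t)) (h0 : θ 0 = 0) (t : ℝ) : θ t = t := by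
  have hcomp : γ = γ' ∘ θ := funext hθ
  rcases le_total 0 t with ht | ht
  · have hθt : (0 : ℝ) ≤ θ t := by simpa [h0] using θ.monotone ht
    have himage : γ '' Icc 0 t = γ' '' Icc 0 (θ t) := by
      rw [hcomp, image_comp, θ.image_Icc, h0]
    have := h.sub_eq_sub_of_image_eq h' ht hθt himage
    linarith
  · have hθt : θ t ≤ (0 : ℝ) := by simpa [h0] using θ.monotone ht
    have himage : γ '' Icc t 0 = γ' '' Icc (θ t) 0 := by
      rw [hcomp, image_comp, θ.image_Icc, h0]
    have := h.sub_eq_sub_of_image_eq h' ht hθt himage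
    linarith

/-- Two naturally parametrised paths differing by an increasing time change of `ℝ` fixing the
time origin are equal — the uniqueness of Zhan's `𝒫(γ)`.
[cite: Zhan2021SLELoopMeasures, Rem. 2.4 / proof of Cor. 4.7] -/
theorem IsNaturallyParametrized.eq_of_orderIso {d : ℝ} {γ γ' : ℝ → ℂ}
    (h : IsNaturallyParametrized d γ) (h' : IsNaturallyParametrized d γ') (θ : ℝ ≃o ℝ)
    (hθ : ∀ t, γ t = γ' (θ t)) (h0 : θ 0 = 0) : γ = γ' :=
  funext fun t ↦ by rw [hθ t, h.orderIso_apply_eq h' θ hθ h0 t]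

/-- **Rigidity on the forward half-line** (the clause `γ̂|[0, ∞) = η₂ ∘ e`, `e : ℝ≥0 ≃o ℝ≥0`, of
`IsTwoSidedWholePlaneSLENatLaw`): if `γ t = γ' (φ t)` for all `t ≥ 0` with an increasing time
change `φ` of `[0, ∞)` and both paths are naturally parametrised, then `φ = id`; so two natural
parametrisations of the same forward arm agree. [cite: Zhan2021SLELoopMeasures, Rem. 2.4] -/
theorem IsNaturallyParametrized.orderIso_nnreal_apply_eq {d : ℝ} {γ γ' : ℝ → ℂ}
    (h : IsNaturallyParametrized d γ) (h' : IsNaturallyParametrized d γ') (φ : ℝ≥0 ≃o ℝ≥0)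
    (hφ : ∀ t : ℝ≥0, γ t = γ' (φ t)) (t : ℝ≥0) : φ t = t := by
  have h0 : φ 0 = 0 := by simpa using φ.map_bot
  have himage : γ '' Icc (0 : ℝ) t = γ' '' Icc (0 : ℝ) (φ t) := by
    have e1 : Icc (0 : ℝ) t = NNReal.toReal '' Icc 0 t := by
      rw [NNReal.image_coe_Icc, NNReal.coe_zero]
    have e2 : Icc (0 : ℝ) (φ t) = NNReal.toReal '' (φ '' Icc 0 t) := by
      rw [φ.image_Icc, h0, NNReal.image_coe_Icc, NNReal.coe_zero]
    rw [e1, e2]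
    simp only [← image_comp]
    exact image_congr fun u _ ↦ hφ u
  have := h.sub_eq_sub_of_image_eq h' (NNReal.coe_nonneg t) (NNReal.coe_nonneg (φ t)) himage
  apply NNReal.coe_injective
  linarith

/-- **Rigidity on the backward open half-line** (the clause `γ̂|(-∞, 0) = η₁ ∘ e'` of
`IsTwoSidedWholePlaneSLENatLaw`; two such clauses differ by an order automorphism of `Iio 0`):
if `γ t = γ' (ψ t)` for all `t < 0` with `ψ : Iio 0 ≃o Iio 0` and both paths are naturally
parametrised, then `ψ = id` — corresponding arcs have equal natural length, so `ψ` is a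
translation, and a translation of `(-∞, 0)` onto itself is the identity.
[cite: Zhan2021SLELoopMeasures, Rem. 2.4] -/
theorem IsNaturallyParametrized.orderIso_Iio_apply_eq {d : ℝ} {γ γ' : ℝ → ℂ}
    (h : IsNaturallyParametrized d γ) (h' : IsNaturallyParametrized d γ')
    (ψ : Iio (0 : ℝ) ≃o Iio (0 : ℝ)) (hψ : ∀ t : Iio (0 : ℝ), γ t = γ' (ψ t))
    (t : Iio (0 : ℝ)) : ψ t = t := by
  -- corresponding arcs have the same natural length
  have hlen : ∀ s t : Iio (0 : ℝ), s ≤ t → (t : ℝ) - s = (ψ t : ℝ) - ψ s := by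
    intro s t hst
    have himage : γ '' Icc (s : ℝ) t = γ' '' Icc (ψ s : ℝ) (ψ t) := by
      rw [← Set.image_subtype_val_Icc, ← Set.image_subtype_val_Icc, ← ψ.image_Icc]
      simp only [← image_comp]
      exact image_congr fun u _ ↦ hψ u
    exact h.sub_eq_sub_of_image_eq h' (by exact_mod_cast hst) (by exact_mod_cast ψ.monotone hst)
      himage
  -- hence `ψ` is the translation by `c := ψ t - t`
  have hconst : ∀ s : Iio (0 : ℝ), (ψ s : ℝ) - s = (ψ t : ℝ) - t := by
    intro s
    rcases le_total s t with hst | hts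
    · have := hlen s t hst; linarith
    · have := hlen t s hts; linarith
  -- and `c = 0`, since `ψ` maps `(-∞, 0)` onto itself
  suffices hc : (ψ t : ℝ) - t = 0 from Subtype.ext (by linarith)
  rcases lt_trichotomy ((ψ t : ℝ) - t) 0 with hneg | hc | hpos
  · exfalso
    -- the point `c/2 ∈ (-∞, 0)` would have the positive preimage `-c/2`
    have hu : ((ψ t : ℝ) - t) / 2 < 0 := by linarith
    have h1 := hconst (ψ.symm ⟨_, hu⟩)
    rw [ψ.apply_symm_apply] at h1
    have h2 : ((ψ.symm ⟨_, hu⟩ : Iio (0 : ℝ)) : ℝ) < 0 := (ψ.symm ⟨_, hu⟩).2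
    simp only at h1
    linarith
  · exact hc
  · exfalso
    -- the point `-c/2 ∈ (-∞, 0)` would have the positive image `c/2`
    have hu : -(((ψ t : ℝ) - t) / 2) < 0 := by linarith
    have h1 := hconst ⟨_, hu⟩
    have h2 : ((ψ ⟨_, hu⟩ : Iio (0 : ℝ)) : ℝ) < 0 := (ψ ⟨_, hu⟩).2
    simp only at h1
    linarith

/-- Reversal keeps the root: `(reversePath γ) 0 = γ 0`. [folklore] -/
theorem reversePath_apply_zero (γ : C(ℝ, ℂ)) : reversePath γ 0 = γ 0 := by
  simp

/-- Reversal is an involution on laws: `(μ.map reversePath).map reversePath = μ`. [folklore] -/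
theorem map_reversePath_map_reversePath (μ : Measure C(ℝ, ℂ)) :
    (μ.map reversePath).map reversePath = μ := by
  rw [Measure.map_map measurable_reversePath measurable_reversePath]
  have : reversePath ∘ reversePath = id := funext reversePath_reversePath
  rw [this, Measure.map_id]

/-- **Reversibility from closure under reversal, given well-definedness** (the shape of the
transfer in Zhan (2021), §2.2 (i) / proof of Cor. 4.7): if the class of two-sided whole-plane
SLE_κ natural laws (`0 < κ < 8`) is closed under path reversal — i.e. the reversed loop is again a
two-sided whole-plane SLE_κ loop from `∞` to `∞` through `0` whose Minkowski content
parametrisation rooted at `0` is the reversed path — then, granted the well-definedness fact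
`IsTwoSidedWholePlaneSLENatLaw.unique`, every such law is invariant under `reversePath`.
[cite: Zhan2021SLELoopMeasures, §2.2] -/
theorem IsTwoSidedWholePlaneSLENatLaw.map_reversePath_of_unique
    (huniq : IsTwoSidedWholePlaneSLENatLaw.unique)
    (hrev : ∀ (κ : ℝ≥0) (μ : Measure C(ℝ, ℂ)), 0 < κ → κ < 8 →
      IsTwoSidedWholePlaneSLENatLaw κ μ → IsTwoSidedWholePlaneSLENatLaw κ (μ.map reversePath)) :
    IsTwoSidedWholePlaneSLENatLaw.map_reversePath :=
  fun κ μ hκ hκ' h ↦ huniq κ _ _ (hrev κ μ hκ hκ' h) h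

/-- Conversely, reversal invariance of the natural laws makes their class closed under reversal.
[cite: Zhan2021SLELoopMeasures, §2.2] -/
theorem IsTwoSidedWholePlaneSLENatLaw.reversePath_of_map_reversePath
    (h : IsTwoSidedWholePlaneSLENatLaw.map_reversePath) {κ : ℝ≥0} {μ : Measure C(ℝ, ℂ)}
    (hκ : 0 < κ) (hκ' : κ < 8) (hμ : IsTwoSidedWholePlaneSLENatLaw κ μ) :
    IsTwoSidedWholePlaneSLENatLaw κ (μ.map reversePath) := by
  rw [h κ μ hκ hκ' hμ]
  exact hμ

end Reversibility

/-! ### The arms determine the natural parametrisation; reversibility from reversed pairs -/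

section ArmsDetermine

/-- **Rigidity of the two-sided natural parametrisation, half-line by half-line**: two paths
parametrised by `d`-dimensional Minkowski content which are increasing reparametrisations of each
other separately on the forward half-line `[0, ∞)` (`φ : ℝ≥0 ≃o ℝ≥0`) and on the backward open
half-line `(-∞, 0)` (`ψ : Iio 0 ≃o Iio 0`) are equal (`orderIso_nnreal_apply_eq`,
`orderIso_Iio_apply_eq`). Zhan (2021), Rem. 2.4 and proof of Cor. 4.7 (uniqueness of the
Minkowski content parametrisation `𝒫(γ)` with `𝒫(γ)(0) = 0`).
[cite: Zhan2021SLELoopMeasures, Rem. 2.4 / proof of Cor. 4.7] -/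
theorem IsNaturallyParametrized.eq_of_orderIso_halves {d : ℝ} {γ γ' : ℝ → ℂ}
    (h : IsNaturallyParametrized d γ) (h' : IsNaturallyParametrized d γ')
    (φ : ℝ≥0 ≃o ℝ≥0) (hφ : ∀ t : ℝ≥0, γ t = γ' (φ t))
    (ψ : Iio (0 : ℝ) ≃o Iio (0 : ℝ)) (hψ : ∀ t : Iio (0 : ℝ), γ t = γ' (ψ t)) : γ = γ' := by
  funext t
  rcases le_or_gt 0 t with ht | ht
  · have e := hφ ⟨t, ht⟩
    rw [h.orderIso_nnreal_apply_eq h' φ hφ ⟨t, ht⟩] at e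
    exact e
  · have e := hψ ⟨t, ht⟩
    rw [h.orderIso_Iio_apply_eq h' ψ hψ ⟨t, ht⟩] at e
    simpa using e

/-- **The arms determine the natural parametrisation** (uniqueness of Zhan's `𝒫(γ)`): if `γ` and
`γ'` are both parametrised by `d`-dimensional Minkowski content, both trace the arm `η₂` on
`[0, ∞)` through increasing time changes of `[0, ∞)` and both trace the arm `η₁` on `(-∞, 0)`
through increasing time changes onto `ℝ` (the almost-sure clauses of
`IsTwoSidedWholePlaneSLENatLaw`), then `γ = γ'`: the two time changes of each half-line differ by
an order automorphism, which is the identity by rigidity. Zhan (2021), proof of Cor. 4.7 ("there is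
a unique Minkowski content parametrization of `γ`, denoted by `𝒫(γ)`, such that `𝒫(γ)(0) = 0`").
[cite: Zhan2021SLELoopMeasures, proof of Cor. 4.7] -/
theorem IsNaturallyParametrized.eq_of_arms {d : ℝ} {γ γ' : ℝ → ℂ} {η₁ : ℝ → ℂ} {η₂ : ℝ≥0 → ℂ}
    (h : IsNaturallyParametrized d γ) (h' : IsNaturallyParametrized d γ')
    (he : ∃ e : ℝ≥0 ≃o ℝ≥0, ∀ t : ℝ≥0, γ t = η₂ (e t))
    (he' : ∃ e' : Iio (0 : ℝ) ≃o ℝ, ∀ t : Iio (0 : ℝ), γ t = η₁ (e' t))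
    (hf : ∃ f : ℝ≥0 ≃o ℝ≥0, ∀ t : ℝ≥0, γ' t = η₂ (f t))
    (hf' : ∃ f' : Iio (0 : ℝ) ≃o ℝ, ∀ t : Iio (0 : ℝ), γ' t = η₁ (f' t)) : γ = γ' := by
  obtain ⟨e, he⟩ := he
  obtain ⟨e', he'⟩ := he'
  obtain ⟨f, hf⟩ := hf
  obtain ⟨f', hf'⟩ := hf'
  refine h.eq_of_orderIso_halves h' (e.trans f.symm) (fun t ↦ ?_) (e'.trans f'.symm) (fun t ↦ ?_)
  · rw [OrderIso.trans_apply, hf, OrderIso.apply_symm_apply, he]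
  · rw [OrderIso.trans_apply, hf', OrderIso.apply_symm_apply, he']

variable {Ω : Type*} [MeasurableSpace Ω]

/-- **On a space carrying the two arms, the natural parametrisation is almost surely unique**: two
random two-sided paths satisfying the almost-sure clauses of `IsTwoSidedWholePlaneSLENatLaw`
(naturally `d`-parametrised, rooted at `0`, tracing `η₂` on `[0, ∞)` and `η₁` on `(-∞, 0)`) with
respect to the same arms `(η₁, η₂)` are almost surely equal. Zhan (2021), proof of Cor. 4.7
(uniqueness of `𝒫(γ)`). [cite: Zhan2021SLELoopMeasures, proof of Cor. 4.7] -/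
theorem natParam_ae_eq_of_arms {d : ℝ} {P : Measure Ω} {η₁ : Ω → ℝ → ℂ} {η₂ : Ω → ℝ≥0 → ℂ}
    {γ γ' : Ω → C(ℝ, ℂ)}
    (hγ : ∀ᵐ ω ∂P, IsNaturallyParametrized d (γ ω) ∧ γ ω 0 = 0 ∧
        (∃ e : ℝ≥0 ≃o ℝ≥0, ∀ t : ℝ≥0, γ ω t = η₂ ω (e t)) ∧
        (∃ e' : Iio (0 : ℝ) ≃o ℝ, ∀ t : Iio (0 : ℝ), γ ω t = η₁ ω (e' t)))
    (hγ' : ∀ᵐ ω ∂P, IsNaturallyParametrized d (γ' ω) ∧ γ' ω 0 = 0 ∧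
        (∃ e : ℝ≥0 ≃o ℝ≥0, ∀ t : ℝ≥0, γ' ω t = η₂ ω (e t)) ∧
        (∃ e' : Iio (0 : ℝ) ≃o ℝ, ∀ t : Iio (0 : ℝ), γ' ω t = η₁ ω (e' t))) :
    γ =ᵐ[P] γ' := by
  filter_upwards [hγ, hγ'] with ω ⟨h1, _, h2, h3⟩ ⟨h1', _, h2', h3'⟩
  exact ContinuousMap.ext (congrFun (h1.eq_of_arms h1' h2 h3 h2' h3'))

/-- **The arms determine the natural law**: two random natural parametrisations of the same pair of
arms have the same law — the parametrisation half of the well-definedness of the two-sided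
whole-plane SLE_κ natural law (`IsTwoSidedWholePlaneSLENatLaw.unique`; the other half is the
uniqueness in law of the arms). Zhan (2021), proof of Cor. 4.7. [cite: Zhan2021SLELoopMeasures, proof of Cor. 4.7] -/
theorem map_natParam_eq_of_arms {d : ℝ} {P : Measure Ω} {η₁ : Ω → ℝ → ℂ} {η₂ : Ω → ℝ≥0 → ℂ}
    {γ γ' : Ω → C(ℝ, ℂ)}
    (hγ : ∀ᵐ ω ∂P, IsNaturallyParametrized d (γ ω) ∧ γ ω 0 = 0 ∧
        (∃ e : ℝ≥0 ≃o ℝ≥0, ∀ t : ℝ≥0, γ ω t = η₂ ω (e t)) ∧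
        (∃ e' : Iio (0 : ℝ) ≃o ℝ, ∀ t : Iio (0 : ℝ), γ ω t = η₁ ω (e' t)))
    (hγ' : ∀ᵐ ω ∂P, IsNaturallyParametrized d (γ' ω) ∧ γ' ω 0 = 0 ∧
        (∃ e : ℝ≥0 ≃o ℝ≥0, ∀ t : ℝ≥0, γ' ω t = η₂ ω (e t)) ∧
        (∃ e' : Iio (0 : ℝ) ≃o ℝ, ∀ t : Iio (0 : ℝ), γ' ω t = η₁ ω (e' t))) :
    P.map γ = P.map γ' :=
  Measure.map_congr (natParam_ae_eq_of_arms hγ hγ')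

/-- **Reversibility of the natural law from a reversed pair on the same space** (the transfer of
Zhan (2021), §2.2 (i) to the Minkowski content parametrisation, Rem. 2.4 / proof of Cor. 4.7):
if `μ = law(γ̂)` for a random path `γ̂` that is almost surely naturally parametrised and rooted at
`0`, and the probability space carries a two-sided whole-plane SLE_κ pair `(η₁', η₂')` traced by the
REVERSED path — `γ̂(-t)`, `t ≥ 0`, runs along `η₂'` and `γ̂(-t)`, `t < 0`, along `η₁'`, through
increasing time changes — then `t ↦ γ̂(-t)` is the natural parametrisation of that pair, so
`μ.map reversePath` is a two-sided whole-plane SLE_κ natural law. [cite: Zhan2021SLELoopMeasures, §2.2 (i) / Rem. 2.4] -/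
theorem isTwoSidedWholePlaneSLENatLaw_map_reversePath_of_reversedPair {κ : ℝ≥0}
    {μ : Measure C(ℝ, ℂ)} {Ω : Type} [MeasurableSpace Ω] {P : Measure Ω}
    {η₁' : Ω → ℝ → ℂ} {η₂' : Ω → ℝ≥0 → ℂ} {γ : Ω → C(ℝ, ℂ)} (hγm : Measurable γ)
    (hμ : μ = P.map γ)
    (hγ : ∀ᵐ ω ∂P, IsNaturallyParametrized (1 + (κ : ℝ) / 8) (γ ω) ∧ γ ω 0 = 0)
    (hpair' : IsTwoSidedWholePlaneSLEPair κ P η₁' η₂')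
    (hrev : ∀ᵐ ω ∂P, (∃ e : ℝ≥0 ≃o ℝ≥0, ∀ t : ℝ≥0, γ ω (-(t : ℝ)) = η₂' ω (e t)) ∧
        (∃ e' : Iio (0 : ℝ) ≃o ℝ, ∀ t : Iio (0 : ℝ), γ ω (-(t : ℝ)) = η₁' ω (e' t))) :
    IsTwoSidedWholePlaneSLENatLaw κ (μ.map reversePath) := by
  refine ⟨Ω, ‹_›, P, η₁', η₂', fun ω ↦ reversePath (γ ω), hpair',
    measurable_reversePath.comp hγm, ?_, ?_⟩
  · rw [hμ, Measure.map_map measurable_reversePath hγm]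
    rfl
  · filter_upwards [hγ, hrev] with ω ⟨h1, h0⟩ ⟨h2, h3⟩
    exact ⟨h1.reversePath, by simpa using h0, by simpa using h2, by simpa using h3⟩

/-- **Reversibility of the natural law from reversibility at the level of arms, given
well-definedness.** Hypothesis `hrev` is Zhan's reversibility (i) of two-sided whole-plane SLE_κ
(`0 < κ < 8`) phrased for the arms: whenever `γ̂` is the natural parametrisation of a two-sided
whole-plane SLE_κ pair `(η₁, η₂)` on `(Ω, P)`, the same space carries a two-sided whole-plane SLE_κ
pair `(η₁', η₂')` (first arm: the reversed second arm, a whole-plane SLE_κ(2) from `∞` to `0`;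
second arm: the reversed first arm, chordal SLE_κ in the remaining domain) traced by `t ↦ γ̂(-t)`
— Zhan (2021), §2.2: "From the resampling property of two-sided radial SLE_κ, and the
reversibility of whole-plane SLE_κ(2) and chordal SLE_κ ([MS3, MS4, Zhan 2008]) … (i) the reversal
of `γ` has the same law (modulo a time change) as `γ`" (those inputs are not in the tree; `hrev` is
a hypothesis, not a vendored fact). Granted also the well-definedness fact
`IsTwoSidedWholePlaneSLENatLaw.unique`, the named fact `map_reversePath` follows
(`map_reversePath_of_unique` and `isTwoSidedWholePlaneSLENatLaw_map_reversePath_of_reversedPair`).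
[cite: Zhan2021SLELoopMeasures, §2.2 (i)] -/
theorem IsTwoSidedWholePlaneSLENatLaw.map_reversePath_of_reversedPairs
    (huniq : IsTwoSidedWholePlaneSLENatLaw.unique)
    (hrev : ∀ (κ : ℝ≥0), 0 < κ → κ < 8 → ∀ (Ω : Type) (_ : MeasurableSpace Ω) (P : Measure Ω)
      (η₁ : Ω → ℝ → ℂ) (η₂ : Ω → ℝ≥0 → ℂ) (γ : Ω → C(ℝ, ℂ)),
      IsTwoSidedWholePlaneSLEPair κ P η₁ η₂ → Measurable γ →
      (∀ᵐ ω ∂P, IsNaturallyParametrized (1 + (κ : ℝ) / 8) (γ ω) ∧ γ ω 0 = 0 ∧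
        (∃ e : ℝ≥0 ≃o ℝ≥0, ∀ t : ℝ≥0, γ ω t = η₂ ω (e t)) ∧
        (∃ e' : Iio (0 : ℝ) ≃o ℝ, ∀ t : Iio (0 : ℝ), γ ω t = η₁ ω (e' t))) →
      ∃ (η₁' : Ω → ℝ → ℂ) (η₂' : Ω → ℝ≥0 → ℂ), IsTwoSidedWholePlaneSLEPair κ P η₁' η₂' ∧
        ∀ᵐ ω ∂P, (∃ e : ℝ≥0 ≃o ℝ≥0, ∀ t : ℝ≥0, γ ω (-(t : ℝ)) = η₂' ω (e t)) ∧
          (∃ e' : Iio (0 : ℝ) ≃o ℝ, ∀ t : Iio (0 : ℝ), γ ω (-(t : ℝ)) = η₁' ω (e' t))) :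
    IsTwoSidedWholePlaneSLENatLaw.map_reversePath := by
  refine map_reversePath_of_unique huniq fun κ μ hκ hκ' hμ ↦ ?_
  obtain ⟨Ω, _, P, η₁, η₂, γ, hpair, hγm, hμ, hclauses⟩ := hμ
  obtain ⟨η₁', η₂', hpair', hrev'⟩ := hrev κ hκ hκ' Ω ‹_› P η₁ η₂ γ hpair hγm hclauses
  exact isTwoSidedWholePlaneSLENatLaw_map_reversePath_of_reversedPair hγm hμ
    (hclauses.mono fun ω h ↦ ⟨h.1, h.2.1⟩) hpair' hrev'

end ArmsDetermine

end Literature.Probability.RandomPlanarGeometry
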